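import Summits.AtomisticToContinuum.Crystallization.Theorems.FrustratedLawDichotomyStrainedPatchHomEntryLeafHTA2QCellB08M1

/-!
# THE `0.8 t_b` PRODUCTION CELL `cT080 × wB08M`, part 2: ★★★ the certificate side `htCertSideA2Q pB08M2 QB08M GnB08M JB08 cT080 wB08M = true`
# (27623 `(H) HomFloor (1/625)`, hcp half; hand-1 g36; critic row 1360 (3)/(4))

decomp-a2c hand-1 g36.  KERNEL: `restB08M2` (`htCertRestA2`: ball / jac / straddlers / PSD confinement / curvature floor `λ₁ = 0.56` / far Jacobians / guards),
`linB08M2` (`1102837292082 ≤ 1104000000000`), `farB08M2` (`1154916260626 ≤ 1163000000000`); with `…CellB08M1.qB08M_0/1/2`: ★★★ `htCertSideA2Q_B08M2`.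

Kernel facts + assembly; 0 sorry; standard axioms; no definitions.  `--supports stmt-AtomisticToContinuum-27623`.
-/

namespace Summit.AtomisticToContinuum.Crystallization.Theorems.FrustratedLawDichotomyStrainedPatchHomEntryLeafHT

open Literature.Analysis.ValidatedNumerics.Numerics
open Summit.AtomisticToContinuum.Crystallization.Theorems.FrustratedLawDichotomyStrainedPatchHomCertTree (CertTree treeOK)
open Summit.AtomisticToContinuum.Crystallization.Theorems.FrustratedLawDichotomyStrainedPatchHomEntryTable (muRec)
open Summit.AtomisticToContinuum.Crystallization.Theorems.FrustratedLawDichotomyStrainedPatchHomEntryFitTolerance (cT080)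
open Summit.AtomisticToContinuum.Crystallization.Theorems.FrustratedLawDichotomyStrainedPatchHomSlopeLJ
open Summit.AtomisticToContinuum.Crystallization.Theorems.FrustratedLawDichotomyStrainedPatchHomSlopeLJAffine
open Summit.AtomisticToContinuum.Crystallization.Theorems.FrustratedLawDichotomyStrainedPatchHomSlopeLJAffine2Kit

set_option maxRecDepth 100000 in
set_option maxHeartbeats 4000000 in
/-- ★ KERNEL: the non-slope conjuncts of the certificate side at `cT080 × wB08M`. -/
theorem restB08M2 : htCertRestA2 pB08M2 JB08 cT080 wB08M = true := by
  decide +kernel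

set_option maxRecDepth 100000 in
set_option maxHeartbeats 4000000 in
/-- ★ KERNEL: `g₀ + lin + ⌈√ΣQ²⌉ + rem3 + nai = 1102837292082 ≤ GnB08M`. -/
theorem linB08M2 : g0LJ cT080 (htScA2F cT080 wB08M JB08 (htNearU cT080 wB08M)) + linLJA cT080 wB08M JB08 (htScA2F cT080 wB08M JB08 (htNearU cT080 wB08M)) + sqrtQ QB08M +
    rem3LJ cT080 (hullW JB08 wB08M) (htScA2F cT080 wB08M JB08 (htNearU cT080 wB08M)) + naiSLJ cT080 (hullW JB08 wB08M) (htSnA2F cT080 wB08M JB08 (htNearU cT080 wB08M)) ≤ GnB08M := by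
  decide +kernel

set_option maxRecDepth 100000 in
set_option maxHeartbeats 4000000 in
/-- KERNEL: `GnB08M + far₁ + far₂ = 1154916260626 ≤ Gs`. -/
theorem farB08M2 : GnB08M + htGsNA cT080 wB08M JB08 (htFar1U cT080 wB08M) + htGsNA cT080 wB08M JB08 (htFar2U cT080 wB08M) ≤ pB08M2.Gs := by
  decide +kernel

/-- ★★★ **THE SECOND-ORDER AFFINE CERTIFICATE SIDE OF THE `0.8 t_b` FIVE-COARSE CELL HOLDS** (six kernel facts; slack `0.7 %` of `Gs`). [assembly] -/
theorem htCertSideA2Q_B08M2 : htCertSideA2Q pB08M2 QB08M GnB08M JB08 cT080 wB08M = true :=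
  htCertSideA2Q_of_parts restB08M2 qB08M_0 qB08M_1 qB08M_2 linB08M2 farB08M2

end Summit.AtomisticToContinuum.Crystallization.Theorems.FrustratedLawDichotomyStrainedPatchHomEntryLeafHT
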